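import Literature.MathematicalPhysics.QuantumFieldTheory.Balaban1983to89.B6Partition118KLevelTorusCentral

/-!
# `Balaban1983to89.B6Partition118KLevelTorusBinders` — T. Bałaban, *Propagators and renormalization transformations for lattice gauge theories. II*,
# Commun. Math. Phys. **96** (1984) 223–250 [Balaban1984PropagatorsII], (2.36) p. 229, (2.89)–(2.92) p. 239, (2.134) p. 247: THE (2.134)-BINDERS OF THE
# PERIODIC PARTITION `{h^T_□}` IN THE TORUS METRIC — gen 25's box binders of the central cube of the canonical chart, transported by gen 25's
# `…B6TorusDepthDistance.lip_transfer`/`gap_transfer`, and the fine-step sizes with torus neighbours (file 4 of route (A) of B6-CLOSURE §5 item 11 /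
# GAPS G-B6-p38-04)

statement-level skeleton of published theorems with citation tags; proofs where landed; nothing here is a claim about the Yang–Mills mass gap

PDF held: `paper:balaban1984-cmp96-propagators-rt-ii` (journal page = PDF page + 222): p. 229 [PDF 7] ((2.36)), p. 231 [PDF 9] ((2.46)), p. 239 [PDF 17]
((2.89)–(2.92)), p. 247 [PDF 25] ((2.134): *"h_□′(x′) − h_□′(x) can be estimated by O(1)M^{−1}d(y, y′) … ζ_□(y) − 1 = 0 for d(y, y′) ≦ M"*, with `d` the
distance (2.46) OF THE TORUS); read from the tree transcriptions in `…B6Partition118KLevelFineLip`, `…B6TorusDepthDistance`.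

CITATION HEADER (lean-in-tree rule) — WHAT IS REPRODUCED.  Phase-2 file of the `lit-balaban` typed skeleton (HOME `run/shared/lean/pub/lit-balaban/`), seat
**p38 gen 26**; SKELETON rows **B6.Eq2.36** × **B6.Eq2.134** × **B6.Eq2.91** (cells only; decls of record untouched; owner r03, referee ref-4).  Files 1–3
(`…B6Partition118KLevelTorus`, `…Chart`, `…Central`) built the periodic family `hT` (`Σ_□ hT² = 1` on `T_η`), its chart dictionary, the central cube `cc c` of the
canonical chart `Dch D c` with `hT D c = pullT svec (hF (Dch D c) (cc c))`, the `S_k`-depth of its collar and the torus sets `QT`/`QbigT`/`zetaT`.  THIS FILE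
delivers the binders of `…B6Ineq2134KFamKLevelTorus.h2134_kFam_torus` / r03's `prop26_2136_V1_of_2134_eq291` IN THE TORUS METRIC `d_T = (bondT D).dist`,
`M = L·M_h` (`L ≥ 2`, `M_h ≥ 2`, `R ≥ 2L`, `P_μ ≥ 5`):
* §1 THE THRESHOLD `T := M_h/(2L) = M/(2L²)` of gen 25's transfers (`threshold`: `T·L^{j+2} ≤ S_k − 2`, `T < R·M`) and **`hLip` ON THE TORUS**: `|hT c z′ − hT c z| ≤ (sLipT/M)·(d_T(y(z), y(z′)) + 1)`, `sLipT = max(sLipF, 4L²)` (gen 25's `abs_hF_sub_le_geom` through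
  `lip_transfer` at the threshold `T = M/(2L²)`);
* §2 **`hgap` ON THE TORUS**: `Y ∉ QbigT c`, `Y″ ∈ QT c ⟹ (1/(2L²))·M ≤ d_T(Y, Y″)` (gen 25's `gap_Qbig` through `gap_transfer`);
* §3 the fine-step sizes with TORUS neighbours: `|hT c z′ − hT c z| ≤ C1F/(8S/5)` for `|z − z′|_T ≤ 1` (`abs_hT_sub_le_near`),
  `|hT c (z + e_μ) − 2hT c z + hT c (z − e_μ)| ≤ C2F/(8S/5)²` with the torus translates `tshift (±e_μ)` (`abs_hT_second_diff_le`), and the level form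
  `j(y(z)) ≤ j + 1` within `1` of `supp hT c` (`lev_le_of_near_suppT`) — the raw material of the line-1 binders `hcf`, `hc₀`;
* §4 **`partition118_torus`**: the package (`Σ hT² = 1`, `hh1`, `hhS`, `hLip`, `hζ0`, `hζ1`, `hζS`, `hgap`, the two sizes).
No `def : Prop`, no new fact; one def with body (`sLipT`); standard axioms.
HONEST SCOPE / DIVERGENCES. As files 1–3 and gen 25 (normalisation across levels ours; `ζ_□` an indicator of blocks; constants `L`,`d`-dependent, `k`,`M_h`-independent);
`P_μ ≥ 5`; the canonical chart is one admissible choice.  The torus-neighbour form of the sizes is stated with p21's `tshift`; the consumer's lattice derivatives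
(V1 `dE`/`dsE` through r03's charts) rescale.  Integer torus; nothing on d = 4 or the continuum; NOT summit progress.  Unit `lit-balaban-p38` (gen 26), 2026-08-23.
-/

namespace Literature.MathematicalPhysics.QuantumFieldTheory.Balaban1983to89.B6Partition118KLevelTorusBinders

open Finset
open Literature.MathematicalPhysics.QuantumFieldTheory.Balaban1983to89.B4ContourShift (supNorm)
open Literature.MathematicalPhysics.QuantumFieldTheory.Balaban1983to89.B4Reflection242 (boxDom mem_boxDom blk)
open Literature.MathematicalPhysics.QuantumFieldTheory.Balaban1983to89.B4TorusKernel.MultiPeriod (torusSupNorm)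
open Literature.MathematicalPhysics.QuantumFieldTheory.Balaban1983to89.B6MultiLevelBoxOperator (Domains N0 bigSide bigSide_eq one_le_bigSide)
open Literature.MathematicalPhysics.QuantumFieldTheory.Balaban1983to89.B6MultiLevelTorusOperator
  (TDomains tshift tshift_tshift tshift_zero tshift_symm_apply Interior tshift_unitVec_of_interior tshift_neg_unitVec_of_interior unitVec
    torusSupNorm_tshift_sub one_le_of_mem)
open Literature.MathematicalPhysics.QuantumFieldTheory.Balaban1983to89.B6Geom246MultiLevelBox (bset blkOf toR supNorm_eq_dist bond)
open Literature.MathematicalPhysics.QuantumFieldTheory.Balaban1983to89.B6Geom246MultiLevelTorus (bondT blkMap blkMap_surjective torusSupNorm_neg)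
open Literature.MathematicalPhysics.QuantumFieldTheory.Balaban1983to89.B6Cover236MultiLevelBlocks (cubes side side_pos ctr Q)
open Literature.MathematicalPhysics.QuantumFieldTheory.Balaban1983to89.B6Eq238MultiLevelTorus (svec)
open Literature.MathematicalPhysics.QuantumFieldTheory.Balaban1983to89.B6Partition118KLevelFine
  (hF abs_hF_le_one dist_lt_of_hF_ne_zero lev_window_of_dist_lt_three_halves)
open Literature.MathematicalPhysics.QuantumFieldTheory.Balaban1983to89.B6Partition118KLevelFineSizes (C1F C1F_nonneg abs_hF_sub_le_near)
open Literature.MathematicalPhysics.QuantumFieldTheory.Balaban1983to89.B6Partition118KLevelFineSecond (C2F C2F_nonneg abs_hF_second_diff_le)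
open Literature.MathematicalPhysics.QuantumFieldTheory.Balaban1983to89.B6Partition118KLevelFineLip (sLipF sLipF_nonneg abs_hF_sub_le_geom Qbig gap_Qbig)
open Literature.MathematicalPhysics.QuantumFieldTheory.Balaban1983to89.B6TorusDepthDistance
  (SiteDeep lip_transfer gap_transfer min_le_torusSupNorm_sub)
open Literature.MathematicalPhysics.QuantumFieldTheory.Balaban1983to89.B6Partition118KLevelTorus (hT abs_hT_le_one sum_hT_sq)
open Literature.MathematicalPhysics.QuantumFieldTheory.Balaban1983to89.B6Partition118KLevelTorusCentral

variable {d : ℕ} {ℓ Mh k R : ℕ} {P : Fin (d + 1) → ℕ} {D : TDomains d ℓ Mh k P R}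

/-! ## §1  The Lipschitz bound of `h^T_□` in the torus distance (2.46) -/

/-- **THE THRESHOLD OF THE TRANSFERS**: with `T := M_h/(2L)` (`= M/(2L²)`), `0 < T`, `T·L^{j+2} ≤ S_k − 2` for `1 ≤ j ≤ k`, and `T < R·(L·M_h)`.
[cite: Balaban1984PropagatorsII, (2.46) p.231 with (2.60) p.233, bookkeeping] -/
theorem threshold (hℓ : 1 ≤ ℓ) (hMh : 1 ≤ Mh) (hR : 2 * (ℓ + 1) ≤ R) {j : ℕ} (hj : 1 ≤ j) (hjk : j ≤ k) :
    0 < (Mh : ℝ) / (2 * ((ℓ : ℝ) + 1)) ∧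
      (Mh : ℝ) / (2 * ((ℓ : ℝ) + 1)) * (((ℓ + 1) ^ (j + 2) : ℕ) : ℝ) ≤ (((bigSide ℓ Mh k : ℕ) : ℤ) : ℝ) - 2 ∧
      (Mh : ℝ) / (2 * ((ℓ : ℝ) + 1)) < (R : ℝ) * (((ℓ : ℝ) + 1) * Mh) := by
  have hL : (2 : ℝ) ≤ (ℓ : ℝ) + 1 := by
    have h : (1 : ℝ) ≤ ℓ := by exact_mod_cast hℓ
    linarith
  have hM : (1 : ℝ) ≤ Mh := by exact_mod_cast hMh
  have hR' : (4 : ℝ) ≤ R := by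
    have h : 4 ≤ R := by omega
    exact_mod_cast h
  refine ⟨by positivity, ?_, ?_⟩
  · have hpow : (((ℓ + 1) ^ (j + 2) : ℕ) : ℝ) ≤ (((ℓ + 1) ^ (k + 2) : ℕ) : ℝ) := by exact_mod_cast Nat.pow_le_pow_right (by omega) (by omega)
    have e : (((ℓ + 1) ^ (k + 2) : ℕ) : ℝ) = ((ℓ : ℝ) + 1) * (((ℓ + 1) ^ (k + 1) : ℕ) : ℝ) := by push_cast; ring
    have eS : (((bigSide ℓ Mh k : ℕ) : ℤ) : ℝ) = (Mh : ℝ) * (((ℓ + 1) ^ (k + 1) : ℕ) : ℝ) := by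
      rw [Int.cast_natCast]; unfold bigSide; push_cast; ring
    have h4 : (4 : ℝ) ≤ (((ℓ + 1) ^ (k + 1) : ℕ) : ℝ) := by
      have h2 : 2 ≤ ℓ + 1 := by omega
      have h : 4 ≤ (ℓ + 1) ^ (k + 1) :=
        calc 4 = 2 ^ 2 := by norm_num
          _ ≤ (ℓ + 1) ^ 2 := Nat.pow_le_pow_left h2 2
          _ ≤ (ℓ + 1) ^ (k + 1) := Nat.pow_le_pow_right (by omega) (by omega)
      exact_mod_cast h
    rw [eS]
    calc (Mh : ℝ) / (2 * ((ℓ : ℝ) + 1)) * (((ℓ + 1) ^ (j + 2) : ℕ) : ℝ) ≤ (Mh : ℝ) / (2 * ((ℓ : ℝ) + 1)) * (((ℓ + 1) ^ (k + 2) : ℕ) : ℝ) :=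
          mul_le_mul_of_nonneg_left hpow (by positivity)
      _ = (Mh : ℝ) * (((ℓ + 1) ^ (k + 1) : ℕ) : ℝ) / 2 := by rw [e]; field_simp
      _ ≤ (Mh : ℝ) * (((ℓ + 1) ^ (k + 1) : ℕ) : ℝ) - 2 := by nlinarith
  · rw [div_lt_iff₀ (by positivity)]
    have h1 : (Mh : ℝ) ≤ (R : ℝ) * (((ℓ : ℝ) + 1) * Mh) := by
      have h : (1 : ℝ) ≤ (R : ℝ) * ((ℓ : ℝ) + 1) := by nlinarith
      nlinarith
    have h2 : (R : ℝ) * (((ℓ : ℝ) + 1) * Mh) * 1 < (R : ℝ) * (((ℓ : ℝ) + 1) * Mh) * (2 * ((ℓ : ℝ) + 1)) :=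
      mul_lt_mul_of_pos_left (by linarith) (by positivity)
    linarith

/-- the Lipschitz constant on the torus: `max(sLipF, 4L²)` (the second entry bounds the far pairs of gen 25's `lip_transfer` at the threshold `T = M/(2L²)`). OURS.
[cite: Balaban1984PropagatorsII, p.247 («O(1)M^{−1}d(y,y′)»), bookkeeping] -/
noncomputable def sLipT (d ℓ : ℕ) : ℝ := max (sLipF d ℓ) (4 * ((ℓ : ℝ) + 1) ^ 2)

/-- `sLipT ≥ 0`. [cite: Balaban1984PropagatorsII, p.247, bookkeeping] -/
theorem sLipT_nonneg (d ℓ : ℕ) : 0 ≤ sLipT d ℓ := le_max_of_le_left (sLipF_nonneg d ℓ)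

/-- `M = L·M_h > 0`. [cite: Balaban1984PropagatorsII, (2.1) p.224, bookkeeping] -/
theorem M_pos (hMh : 1 ≤ Mh) : (0 : ℝ) < ((ℓ : ℝ) + 1) * Mh := by
  have h : (1 : ℝ) ≤ Mh := by exact_mod_cast hMh
  positivity

/-- **`hLip` ON THE TORUS**: `|h^T_□(z′) − h^T_□(z)| ≤ (sLipT/M)·(d_T(y(z), y(z′)) + 1)` with the TORUS distance (2.46) `d_T = (bondT D).dist`, `M = L·M_h`
(`L ≥ 2`, `M_h ≥ 2`, `R ≥ 2L`, `P_μ ≥ 5`). [cite: Balaban1984PropagatorsII, p.247 («h_□′(x′) − h_□′(x) can be estimated by O(1)M^{−1}d(y,y′)») with (2.46) p.231] -/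
theorem abs_hT_sub_le_distT (hℓ : 1 ≤ ℓ) (hMh : 2 ≤ Mh) (hR : 2 * (ℓ + 1) ≤ R) (hP5 : ∀ μ, 5 ≤ P μ) (c : ↥(cubes D.toDomains))
    (z z' : ↥(boxDom (N0 ℓ Mh k P))) :
    |hT D c z' - hT D c z| ≤ sLipT d ℓ / (((ℓ : ℝ) + 1) * Mh) * (((bondT D).dist (blkOf D.toDomains z) (blkOf D.toDomains z') : ℝ) + 1) := by
  have hMh1 : 1 ≤ Mh := le_trans (by norm_num) hMh
  have hP4 : ∀ μ, 4 ≤ P μ := fun μ => le_trans (by norm_num) (hP5 μ)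
  have hP : ∀ μ, 1 ≤ P μ := one_le_of_four_le hP4
  obtain ⟨hj, hjk⟩ := level_bounds D.toDomains c
  obtain ⟨hT0, hTw, hTR⟩ := threshold (k := k) hℓ hMh1 hR hj hjk
  have key := lip_transfer (D := D) hMh1 hP (svec ℓ k c.1.1 c.1.2) (f := hF (Dch D c) (cc D hMh1 hP4 c)) (w := ((bigSide ℓ Mh k : ℕ) : ℤ)) (j := c.1.1)
    (sL := sLipF d ℓ) (r₀ := 1) (M := ((ℓ : ℝ) + 1) * Mh) (T := (Mh : ℝ) / (2 * ((ℓ : ℝ) + 1))) (M_pos hMh1) hT0 zero_le_one (sLipF_nonneg d ℓ)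
    (fun x => abs_hF_le_one (Dch D c) hMh1 _ x) (fun x hx => blkDeep_of_hF_ne_zero hMh hR hP5 c hx) hTw hTR
    (fun x x' => abs_hF_sub_le_geom (Dch D c) hℓ hMh hP hR _ x x') z z'
  rw [← hT_eq_pullT hMh1 hP4 c] at key
  have e : 2 * (((ℓ : ℝ) + 1) * Mh) / ((Mh : ℝ) / (2 * ((ℓ : ℝ) + 1))) = 4 * ((ℓ : ℝ) + 1) ^ 2 := by
    have hM : (0 : ℝ) < Mh := by
      have h : (1 : ℝ) ≤ Mh := by exact_mod_cast hMh1
      linarith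
    field_simp; ring
  rw [e] at key
  exact key

/-! ## §2  The gap between the outside of `□̃` and `□⁺` in the torus distance -/

/-- **`hgap` ON THE TORUS**: for torus blocks `Y ∉ Score_□`, `Y″ ∈ S_□`: `(1/(2L²))·M ≤ d_T(Y, Y″)`, `M = L·M_h` (`L ≥ 2`, `M_h ≥ 2`, `R ≥ 2L`, `P_μ ≥ 5`).
[cite: Balaban1984PropagatorsII, p.247 («ζ_□(y) − 1 = 0 for d(y, y′) ≦ M, y′ ∈ □′») with (2.46) p.231] -/
theorem gap_QT (hℓ : 1 ≤ ℓ) (hMh : 2 ≤ Mh) (hR : 2 * (ℓ + 1) ≤ R) (hP5 : ∀ μ, 5 ≤ P μ) {hMh1 : 1 ≤ Mh} {hP4 : ∀ μ, 4 ≤ P μ}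
    (c : ↥(cubes D.toDomains)) {Y Y'' : ↥(bset D.toDomains)} (hY : Y ∉ QbigT D hMh1 hP4 c) (hY'' : Y'' ∈ QT D hMh1 hP4 c) :
    1 / (2 * ((ℓ : ℝ) + 1) ^ 2) * (((ℓ : ℝ) + 1) * Mh) ≤ ((bondT D).dist Y Y'' : ℝ) := by
  have hP : ∀ μ, 1 ≤ P μ := one_le_of_four_le hP4
  obtain ⟨hj, hjk⟩ := level_bounds D.toDomains c
  obtain ⟨hT0, hTw, hTR⟩ := threshold (k := k) hℓ hMh1 hR hj hjk
  -- pull the two torus blocks back to chart blocks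
  unfold QT at hY''
  obtain ⟨y'', hy'', rfl⟩ := Finset.mem_image.1 hY''
  obtain ⟨y, rfl⟩ := blkMap_surjective (D := D) hMh1 hP (svec ℓ k c.1.1 c.1.2) Y
  have hy : y ∉ Qbig (Dch D c) (cc D hMh1 hP4 c) := fun hmem => hY (by unfold QbigT; exact Finset.mem_image_of_mem _ hmem)
  have key := gap_transfer (D := D) hMh1 hP (svec ℓ k c.1.1 c.1.2) (S := ↑(Q (Dch D c) (cc D hMh1 hP4 c))) (Score := ↑(Qbig (Dch D c) (cc D hMh1 hP4 c)))
    (w := ((bigSide ℓ Mh k : ℕ) : ℤ)) (j := c.1.1) (m := 1 / (4 * ((ℓ : ℝ) + 1))) (M := ((ℓ : ℝ) + 1) * Mh) (T := (Mh : ℝ) / (2 * ((ℓ : ℝ) + 1)))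
    (M_pos hMh1) hT0 (fun a ha => blkDeep_of_mem_Q hMh hR hP5 c (Finset.mem_coe.1 ha)) hTw hTR
    (fun y₁ y₂ h₁ h₂ => gap_Qbig (Dch D c) hMh1 hP hR (fun hm => h₁ (Finset.mem_coe.2 hm)) (Finset.mem_coe.1 h₂))
    y y'' (fun hm => hy (Finset.mem_coe.1 hm)) (Finset.mem_coe.2 hy'')
  -- `min(1/(4L), T/M) = 1/(2L²)` for `L ≥ 2`
  have hL : (2 : ℝ) ≤ (ℓ : ℝ) + 1 := by
    have h : (1 : ℝ) ≤ ℓ := by exact_mod_cast hℓ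
    linarith
  have hM : (0 : ℝ) < Mh := by
    have h : (1 : ℝ) ≤ Mh := by exact_mod_cast hMh1
    linarith
  have e : (Mh : ℝ) / (2 * ((ℓ : ℝ) + 1)) / (((ℓ : ℝ) + 1) * Mh) = 1 / (2 * ((ℓ : ℝ) + 1) ^ 2) := by field_simp
  rw [e] at key
  have hmin : min (1 / (4 * ((ℓ : ℝ) + 1))) (1 / (2 * ((ℓ : ℝ) + 1) ^ 2)) = 1 / (2 * ((ℓ : ℝ) + 1) ^ 2) := by
    refine min_eq_right ?_
    rw [div_le_div_iff₀ (by positivity) (by positivity)]; nlinarith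
  rw [hmin] at key
  exact key

/-! ## §3  The fine-step sizes with torus neighbours -/

/-- the profile scale of the torus cube `(j, β)`: `8S_j/5` (gen 25's `sF` of the central cube, by `rfl`). [cite: Balaban1984PropagatorsII, p.229, bookkeeping] -/
theorem sF_cc (hMh : 1 ≤ Mh) (hP4 : ∀ μ, 4 ≤ P μ) (c : ↥(cubes D.toDomains)) :
    B6Partition118KLevelFine.sF (Dch D c) (cc D hMh hP4 c) = 8 / 5 * (bigSide ℓ Mh c.1.1 : ℝ) := rfl

/-- a chart site carrying `h_□` is `3`-deep (its block is `S_k`-deep, `S_k ≥ 4`). [cite: Balaban1984PropagatorsII, (2.36) p.229, bookkeeping] -/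
theorem siteDeep_three_of_hF_ne_zero (hℓ : 1 ≤ ℓ) (hMh : 2 ≤ Mh) (hR : 2 * (ℓ + 1) ≤ R) (hP5 : ∀ μ, 5 ≤ P μ) {hMh1 : 1 ≤ Mh} {hP4 : ∀ μ, 4 ≤ P μ}
    (c : ↥(cubes D.toDomains)) {x : ↥(boxDom (N0 ℓ Mh k P))} (h : hF (Dch D c) (cc D hMh1 hP4 c) x ≠ 0) : SiteDeep (N0 ℓ Mh k P) 3 x.1 := by
  have h3 : (3 : ℤ) ≤ ((bigSide ℓ Mh k : ℕ) : ℤ) := by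
    have h : 3 ≤ bigSide ℓ Mh k := by
      unfold bigSide
      calc 3 ≤ 2 * 2 := by norm_num
        _ ≤ Mh * (ℓ + 1) ^ (k + 1) := Nat.mul_le_mul hMh (le_trans (by omega : 2 ≤ ℓ + 1) (Nat.le_self_pow (by omega) _))
    exact_mod_cast h
  exact ((blkDeep_of_hF_ne_zero hMh hR hP5 c h).1 x rfl).mono h3

/-- a `2`-deep site is interior. [cite: Balaban1983RegularityDecay, p.572, dictionary] -/
theorem interior_of_siteDeep {x : ↥(boxDom (N0 ℓ Mh k P))} (h : SiteDeep (N0 ℓ Mh k P) 2 x.1) : Interior (N0 ℓ Mh k P) x :=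
  fun i => by obtain ⟨h1, h2⟩ := h i; constructor <;> omega

/-- two sites at torus distance `≤ 1`, one of them `2`-deep, are at lattice distance `≤ 1`. [cite: Balaban1984PropagatorsII, (2.46) p.231, dictionary (torus vs box)] -/
theorem dist_le_one_of_torus {u v : ↥(boxDom (N0 ℓ Mh k P))} (hu : SiteDeep (N0 ℓ Mh k P) 2 u.1)
    (huv : torusSupNorm (N0 ℓ Mh k P) (u.1 - v.1) ≤ 1) : dist (toR u.1) (toR v.1) ≤ 1 := by
  have key := min_le_torusSupNorm_sub (by norm_num) hu v.2
  rw [← supNorm_eq_dist]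
  rcases min_choice (supNorm (u.1 - v.1)) ((2 : ℤ) : ℝ) with hm | hm
  · rw [hm] at key; exact key.trans huv
  · rw [hm] at key; push_cast at key; linarith

/-- the chart coordinates of two torus sites have the same torus distance. [cite: Balaban1984PropagatorsII, (2.46) p.231, dictionary (charts)] -/
theorem torusSupNorm_σch_symm (c : ↥(cubes D.toDomains)) (z z' : ↥(boxDom (N0 ℓ Mh k P))) :
    torusSupNorm (N0 ℓ Mh k P) (((σch D c).symm z).1 - ((σch D c).symm z').1) = torusSupNorm (N0 ℓ Mh k P) (z.1 - z'.1) := by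
  have e := torusSupNorm_tshift_sub (N0 ℓ Mh k P) (TDomains.tvec ℓ Mh k (svec ℓ k c.1.1 c.1.2)) ((σch D c).symm z) ((σch D c).symm z')
  rw [Equiv.apply_symm_apply, Equiv.apply_symm_apply] at e
  exact e.symm

/-- **THE FIRST-STEP SIZE WITH TORUS NEIGHBOURS**: `|z − z′|_T ≤ 1 ⟹ |h^T_□(z′) − h^T_□(z)| ≤ C1F/(8S/5)` (`L ≥ 2`, `M_h ≥ 2`, `R ≥ 2L`, `P_μ ≥ 5`).
[cite: Balaban1984PropagatorsII, p.247 («|∂h_□| ≤ O(1)(ML^jη)^{−1}»), (2.92) p.239 line 1] -/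
theorem abs_hT_sub_le_near (hℓ : 1 ≤ ℓ) (hMh : 2 ≤ Mh) (hR : 2 * (ℓ + 1) ≤ R) (hP5 : ∀ μ, 5 ≤ P μ) (c : ↥(cubes D.toDomains))
    {z z' : ↥(boxDom (N0 ℓ Mh k P))} (hzz' : torusSupNorm (N0 ℓ Mh k P) (z.1 - z'.1) ≤ 1) :
    |hT D c z' - hT D c z| ≤ C1F d ℓ / (8 / 5 * (bigSide ℓ Mh c.1.1 : ℝ)) := by
  have hMh1 : 1 ≤ Mh := le_trans (by norm_num) hMh
  have hP4 : ∀ μ, 4 ≤ P μ := fun μ => le_trans (by norm_num) (hP5 μ)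
  have hC : 0 ≤ C1F d ℓ / (8 / 5 * (bigSide ℓ Mh c.1.1 : ℝ)) := div_nonneg (C1F_nonneg d ℓ) (by positivity)
  rw [hT_eq_hF_cc hMh1 hP4 c z, hT_eq_hF_cc hMh1 hP4 c z', ← sF_cc hMh1 hP4 c]
  have hT1 : torusSupNorm (N0 ℓ Mh k P) (((σch D c).symm z).1 - ((σch D c).symm z').1) ≤ 1 := by rw [torusSupNorm_σch_symm]; exact hzz'
  have hT1' : torusSupNorm (N0 ℓ Mh k P) (((σch D c).symm z').1 - ((σch D c).symm z).1) ≤ 1 := by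
    rw [torusSupNorm_σch_symm, show z'.1 - z.1 = -(z.1 - z'.1) by abel, torusSupNorm_neg (one_le_of_mem z.2)]; exact hzz'
  by_cases h1 : hF (Dch D c) (cc D hMh1 hP4 c) ((σch D c).symm z) ≠ 0
  · exact abs_hF_sub_le_near (Dch D c) hℓ hMh hR _
      (dist_le_one_of_torus ((siteDeep_three_of_hF_ne_zero hℓ hMh hR hP5 c h1).mono (by norm_num)) hT1)
  by_cases h2 : hF (Dch D c) (cc D hMh1 hP4 c) ((σch D c).symm z') ≠ 0
  · rw [abs_sub_comm]
    exact abs_hF_sub_le_near (Dch D c) hℓ hMh hR _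
      (dist_le_one_of_torus ((siteDeep_three_of_hF_ne_zero hℓ hMh hR hP5 c h2).mono (by norm_num)) hT1')
  push Not at h1 h2
  rw [h1, h2, sub_zero, abs_zero]; exact hC

/-- `x + t·e_μ` as an update. [folklore] -/
private theorem add_single_eq_update (x : Fin (d + 1) → ℤ) (μ : Fin (d + 1)) (t : ℤ) :
    x + Pi.single μ t = Function.update x μ (x μ + t) := by
  funext ν
  by_cases h : ν = μ
  · subst h; simp
  · simp [Function.update_of_ne h, Pi.single_eq_of_ne h]

/-- the chart reads torus translates as translates: `σ_c⁻¹(z + v) = σ_c⁻¹ z + v` on the torus. [cite: Balaban1983RegularityDecay, p.572, dictionary (charts)] -/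
theorem σch_symm_tshift (c : ↥(cubes D.toDomains)) (v : Fin (d + 1) → ℤ) (z : ↥(boxDom (N0 ℓ Mh k P))) :
    (σch D c).symm (tshift (N0 ℓ Mh k P) v z) = tshift (N0 ℓ Mh k P) v ((σch D c).symm z) := by
  rw [tshift_symm_apply, tshift_symm_apply, tshift_tshift, tshift_tshift, add_comm v (-TDomains.tvec ℓ Mh k (svec ℓ k c.1.1 c.1.2))]

/-- if `σ_c⁻¹ z` is not interior, no torus neighbour `z + v`, `v = ±e_μ`, carries `h_□` (carriers are `3`-deep; `z = (z + v) − v` would be interior).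
[cite: Balaban1984PropagatorsII, (2.36) p.229, bookkeeping] -/
theorem hF_tshift_eq_zero_of_not_interior (hℓ : 1 ≤ ℓ) (hMh : 2 ≤ Mh) (hR : 2 * (ℓ + 1) ≤ R) (hP5 : ∀ μ, 5 ≤ P μ) {hMh1 : 1 ≤ Mh} {hP4 : ∀ μ, 4 ≤ P μ}
    (c : ↥(cubes D.toDomains)) {x : ↥(boxDom (N0 ℓ Mh k P))} (hint : ¬ Interior (N0 ℓ Mh k P) x) (μ : Fin (d + 1)) :
    hF (Dch D c) (cc D hMh1 hP4 c) (tshift (N0 ℓ Mh k P) (unitVec μ) x) = 0 ∧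
      hF (Dch D c) (cc D hMh1 hP4 c) (tshift (N0 ℓ Mh k P) (-unitVec μ) x) = 0 := by
  constructor
  · by_contra h
    have hd := siteDeep_three_of_hF_ne_zero hℓ hMh hR hP5 c h
    have hi : Interior (N0 ℓ Mh k P) (tshift (N0 ℓ Mh k P) (unitVec μ) x) := interior_of_siteDeep (hd.mono (by norm_num))
    have hval := tshift_neg_unitVec_of_interior hi μ
    have ex : tshift (N0 ℓ Mh k P) (-unitVec μ) (tshift (N0 ℓ Mh k P) (unitVec μ) x) = x := by
      rw [tshift_tshift, add_neg_cancel, tshift_zero]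
    rw [ex] at hval
    apply hint
    intro i
    obtain ⟨h3, h4⟩ := hd i
    rw [hval, Pi.sub_apply]
    by_cases hiμ : i = μ
    · subst hiμ; rw [Pi.single_eq_same]; omega
    · rw [Pi.single_eq_of_ne hiμ]; omega
  · by_contra h
    have hd := siteDeep_three_of_hF_ne_zero hℓ hMh hR hP5 c h
    have hi : Interior (N0 ℓ Mh k P) (tshift (N0 ℓ Mh k P) (-unitVec μ) x) := interior_of_siteDeep (hd.mono (by norm_num))
    have hval := tshift_unitVec_of_interior hi μ
    have ex : tshift (N0 ℓ Mh k P) (unitVec μ) (tshift (N0 ℓ Mh k P) (-unitVec μ) x) = x := by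
      rw [tshift_tshift, neg_add_cancel, tshift_zero]
    rw [ex] at hval
    apply hint
    intro i
    obtain ⟨h3, h4⟩ := hd i
    rw [hval, Pi.add_apply]
    by_cases hiμ : i = μ
    · subst hiμ; rw [Pi.single_eq_same]; omega
    · rw [Pi.single_eq_of_ne hiμ]; omega

/-- **THE SECOND-STEP SIZE WITH TORUS NEIGHBOURS**: `|h^T_□(z + e_μ) − 2h^T_□(z) + h^T_□(z − e_μ)| ≤ C2F/(8S/5)²` with the torus translates `tshift (±e_μ)`
(`L ≥ 2`, `M_h ≥ 2`, `R ≥ 2L`, `P_μ ≥ 5`). [cite: Balaban1984PropagatorsII, p.247 («|Δh_□| ≤ O(1)(ML^jη)^{−2}»), (2.92) p.239 line 1] -/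
theorem abs_hT_second_diff_le (hℓ : 1 ≤ ℓ) (hMh : 2 ≤ Mh) (hR : 2 * (ℓ + 1) ≤ R) (hP5 : ∀ μ, 5 ≤ P μ) (c : ↥(cubes D.toDomains))
    (μ : Fin (d + 1)) (z : ↥(boxDom (N0 ℓ Mh k P))) :
    |hT D c (tshift (N0 ℓ Mh k P) (unitVec μ) z) - 2 * hT D c z + hT D c (tshift (N0 ℓ Mh k P) (-unitVec μ) z)|
      ≤ C2F d ℓ / (8 / 5 * (bigSide ℓ Mh c.1.1 : ℝ)) ^ 2 := by
  have hMh1 : 1 ≤ Mh := le_trans (by norm_num) hMh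
  have hP4 : ∀ μ, 4 ≤ P μ := fun μ => le_trans (by norm_num) (hP5 μ)
  have hC : 0 ≤ C2F d ℓ / (8 / 5 * (bigSide ℓ Mh c.1.1 : ℝ)) ^ 2 := div_nonneg (C2F_nonneg d ℓ) (by positivity)
  simp only [hT_eq_hF_cc hMh1 hP4 c]
  rw [← sF_cc hMh1 hP4 c, σch_symm_tshift, σch_symm_tshift]
  by_cases hint : Interior (N0 ℓ Mh k P) ((σch D c).symm z)
  · -- interior: the torus neighbours are the lattice neighbours; gen 25's box bound applies
    refine abs_hF_second_diff_le (Dch D c) hℓ hMh1 hR _ μ ?_ ?_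
    · rw [tshift_unitVec_of_interior hint μ, add_single_eq_update]
    · rw [tshift_neg_unitVec_of_interior hint μ, sub_eq_add_neg, ← Pi.single_neg, add_single_eq_update]
  · -- not interior: none of the three sites carries `h`
    have h0 : hF (Dch D c) (cc D hMh1 hP4 c) ((σch D c).symm z) = 0 := by
      by_contra h
      exact hint (interior_of_siteDeep ((siteDeep_three_of_hF_ne_zero hℓ hMh hR hP5 c h).mono (by norm_num)))
    obtain ⟨hp, hm⟩ := hF_tshift_eq_zero_of_not_interior hℓ hMh hR hP5 (hMh1 := hMh1) (hP4 := hP4) c hint μ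
    rw [h0, hp, hm]
    norm_num; exact hC

/-- **THE LEVEL FORM NEAR THE SUPPORT**: if `h^T_□(z′) ≠ 0` and `|z − z′|_T ≤ 1` then the torus block of `z` has level `≤ j + 1` (so the sizes above are
`≤ s₁/(M·L^{j(y)})`, `s₂/(M·L^{2j(y)})` as in gen 25's `…KIdx` §3). [cite: Balaban1984PropagatorsII, (2.2) p.224, p.235, bookkeeping] -/
theorem lev_le_of_near_suppT (hℓ : 1 ≤ ℓ) (hMh : 2 ≤ Mh) (hR : 2 * (ℓ + 1) ≤ R) (hP5 : ∀ μ, 5 ≤ P μ) (c : ↥(cubes D.toDomains))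
    {z z' : ↥(boxDom (N0 ℓ Mh k P))} (h : hT D c z' ≠ 0) (hzz' : torusSupNorm (N0 ℓ Mh k P) (z.1 - z'.1) ≤ 1) :
    (blkOf D.toDomains z).1.1 ≤ c.1.1 + 1 := by
  have hMh1 : 1 ≤ Mh := le_trans (by norm_num) hMh
  have hP4 : ∀ μ, 4 ≤ P μ := fun μ => le_trans (by norm_num) (hP5 μ)
  rw [hT_eq_hF_cc hMh1 hP4 c z'] at h
  -- the torus level of `z` is the chart level of `σ_c⁻¹ z`
  have hlev : (blkOf D.toDomains z).1.1 = (blkOf (Dch D c) ((σch D c).symm z)).1.1 := by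
    rw [← lev_blkOf_σch c ((σch D c).symm z), Equiv.apply_symm_apply]
  rw [hlev]
  have hT1 : torusSupNorm (N0 ℓ Mh k P) (((σch D c).symm z').1 - ((σch D c).symm z).1) ≤ 1 := by
    rw [torusSupNorm_σch_symm, show z'.1 - z.1 = -(z.1 - z'.1) by abel, torusSupNorm_neg (one_le_of_mem z.2)]; exact hzz'
  have hnear := dist_le_one_of_torus ((siteDeep_three_of_hF_ne_zero hℓ hMh hR hP5 c h).mono (by norm_num)) hT1
  have hx'c := dist_lt_of_hF_ne_zero (Dch D c) hMh1 h
  have h2 : (2 : ℝ) ≤ side (Dch D c) (cc D hMh1 hP4 c) := by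
    rw [side_cc]
    have h : 2 ≤ bigSide ℓ Mh c.1.1 := by
      unfold bigSide
      calc 2 ≤ 2 * 1 := by norm_num
        _ ≤ Mh * (ℓ + 1) ^ (c.1.1 + 1) := Nat.mul_le_mul hMh (Nat.one_le_pow _ _ (by omega))
    exact_mod_cast h
  have h32 : dist (toR ((σch D c).symm z).1) (ctr (Dch D c) (cc D hMh1 hP4 c)) < 3 / 2 * side (Dch D c) (cc D hMh1 hP4 c) := by
    rw [dist_comm] at hnear
    linarith [dist_triangle (toR ((σch D c).symm z).1) (toR ((σch D c).symm z').1) (ctr (Dch D c) (cc D hMh1 hP4 c))]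
  exact (lev_window_of_dist_lt_three_halves (Dch D c) hMh1 hR h32).2

/-! ## §4  The package -/

/-- **THE PERIODIC SMOOTH PARTITION (1.118)/(2.36) ON THE TORUS WITH ITS CUT-OFFS AND CONSTANTS IN THE TORUS METRIC**, uniformly in `k`, `M_h ≥ 2`, `P`
(`P_μ ≥ 5`), `D` (`L ≥ 2`, `R ≥ 2L`): `Σ_□ h^T_□² = 1`; `|h^T_□| ≤ 1`; `supp h^T_□` within the blocks of `S_□ = QT`; the Lipschitz bound `(sLipT/M)(d_T + 1)`;
`0 ≤ ζ_□ ≤ 1`, `ζ_□ ≠ 1 ⇒` outside `Score_□ = QbigT`; the gap `(1/(2L²))·M ≤ d_T(Y, Y″)` for `Y ∉ Score_□`, `Y″ ∈ S_□`; and the fine-step sizes with torus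
neighbours — the shapes of the binders `hh1`, `hhS`, `hLip`, `hζ0`, `hζ1`, `hζS`, `hgap` (and the raw sizes behind `hcf`, `hc₀`) of
`…B6Ineq2134KFamKLevelTorus.h2134_kFam_torus` with `blk := blkOf D.toDomains` (`geomTB D`: `M = L·M_h`, `dist = d_T`), `s := sLipT`, `r₀ := 1`, `m := 1/(2L²)`.
[cite: Balaban1984PropagatorsII, (2.36) p.229, (2.89)–(2.92) p.239, (2.134) p.247] -/
theorem partition118_torus (hℓ : 1 ≤ ℓ) (hMh : 2 ≤ Mh) (hR : 2 * (ℓ + 1) ≤ R) (hP5 : ∀ μ, 5 ≤ P μ) (hMh1 : 1 ≤ Mh) (hP4 : ∀ μ, 4 ≤ P μ) :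
    (∀ z : ↥(boxDom (N0 ℓ Mh k P)), ∑ c : ↥(cubes D.toDomains), hT D c z ^ 2 = 1) ∧
    (∀ (c : ↥(cubes D.toDomains)) (z : ↥(boxDom (N0 ℓ Mh k P))), |hT D c z| ≤ 1) ∧
    (∀ (c : ↥(cubes D.toDomains)) (z : ↥(boxDom (N0 ℓ Mh k P))), hT D c z ≠ 0 → blkOf D.toDomains z ∈ QT D hMh1 hP4 c) ∧
    (∀ (c : ↥(cubes D.toDomains)) (z z' : ↥(boxDom (N0 ℓ Mh k P))),
      |hT D c z' - hT D c z| ≤ sLipT d ℓ / (((ℓ : ℝ) + 1) * Mh) * (((bondT D).dist (blkOf D.toDomains z) (blkOf D.toDomains z') : ℝ) + 1)) ∧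
    (∀ (c : ↥(cubes D.toDomains)) (z : ↥(boxDom (N0 ℓ Mh k P))), 0 ≤ zetaT D hMh1 hP4 c z) ∧
    (∀ (c : ↥(cubes D.toDomains)) (z : ↥(boxDom (N0 ℓ Mh k P))), zetaT D hMh1 hP4 c z ≤ 1) ∧
    (∀ (c : ↥(cubes D.toDomains)) (z : ↥(boxDom (N0 ℓ Mh k P))), zetaT D hMh1 hP4 c z ≠ 1 → blkOf D.toDomains z ∉ QbigT D hMh1 hP4 c) ∧
    (∀ (c : ↥(cubes D.toDomains)) (Y Y'' : ↥(bset D.toDomains)), Y ∉ QbigT D hMh1 hP4 c → Y'' ∈ QT D hMh1 hP4 c →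
      1 / (2 * ((ℓ : ℝ) + 1) ^ 2) * (((ℓ : ℝ) + 1) * Mh) ≤ ((bondT D).dist Y Y'' : ℝ)) ∧
    (∀ (c : ↥(cubes D.toDomains)) (z z' : ↥(boxDom (N0 ℓ Mh k P))), torusSupNorm (N0 ℓ Mh k P) (z.1 - z'.1) ≤ 1 →
      |hT D c z' - hT D c z| ≤ C1F d ℓ / (8 / 5 * (bigSide ℓ Mh c.1.1 : ℝ))) ∧
    (∀ (c : ↥(cubes D.toDomains)) (μ : Fin (d + 1)) (z : ↥(boxDom (N0 ℓ Mh k P))),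
      |hT D c (tshift (N0 ℓ Mh k P) (unitVec μ) z) - 2 * hT D c z + hT D c (tshift (N0 ℓ Mh k P) (-unitVec μ) z)|
        ≤ C2F d ℓ / (8 / 5 * (bigSide ℓ Mh c.1.1 : ℝ)) ^ 2) := by
  have hP : ∀ μ, 1 ≤ P μ := one_le_of_four_le hP4
  exact ⟨sum_hT_sq D hMh1 hP, abs_hT_le_one D hMh1 hP, fun c _ h => blkOf_mem_QT_of_hT_ne_zero hMh hR hP4 c h,
    abs_hT_sub_le_distT hℓ hMh hR hP5, zetaT_nonneg hMh1 hP4, zetaT_le_one hMh1 hP4, fun c _ h => not_mem_QbigT_of_zetaT_ne_one hMh1 hP4 c h,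
    fun c _ _ hY hY'' => gap_QT hℓ hMh hR hP5 c hY hY'', fun c _ _ h => abs_hT_sub_le_near hℓ hMh hR hP5 c h,
    fun c μ z => abs_hT_second_diff_le hℓ hMh hR hP5 c μ z⟩

end Literature.MathematicalPhysics.QuantumFieldTheory.Balaban1983to89.B6Partition118KLevelTorusBinders
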